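import Mathlib
import HarnessLib
import Summits.Ventures.LatticeQCDFlow.Exactness.SU2LeapfrogEnergyError
import Summits.Ventures.LatticeQCDFlow.Exactness.SU2MomentumLawMoments

/-!
# THE MEAN ACCEPTANCE OF THE ENGINE'S `n`-STEP `SU(2)` LEAPFROG PROPOSAL IS AT LEAST `1 − O(nε²)`, EXPLICITLY: the pointwise energy-error law averaged over the Gaussian momentum refresh, from every configuration

HONEST FRAMING: exact (Metropolis-corrected) sampling algorithms for lattice gauge theory;
figures of merit are autocorrelation/cost numbers at stated couplings and volumes; no
continuum-physics claim.

Venture `LatticeQCDFlow` (cell pub-lqcd), topic `Exactness`; FANOUT row 14 (`eng-flowhmc`, engine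
`latflow.fthmc`, family B; the row's test battery reports the MEAN Metropolis acceptance of the field-transformed
leapfrog proposal — this file bounds that column from below).  NEW WORK of the cell over the tree:
`SU2LeapfrogEnergyError` (`abs_su2LeapfrogProposalN_energy_error_le`: for ANY action with a bounded,
matrix-sup-Lipschitz coordinate gradient `D = D^ε S` and the consistent half kick `g = −D/(4κ)`, the energy error of
the `n`-step proposal `Ψ_n = sunLeapfrogProposalN pauliCoordι … ε g n` is `≤ n·K(‖p‖ + b)|ε|(8(Σ_l‖p_l‖ + c₁) + c₂)`
pointwise, `b = (2n+1)D_max/(4κ)`, `c₁ = (2n+1)|ι|D_max/(4κ)`, `c₂ = |ι|D_max/κ`), `SU2MomentumLawMoments`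
(`E Σ_l‖p_l‖ = |ι|·2/√(πκ)`, `E (Σ_l‖p_l‖)² ≤ |ι|²·3/(2κ)` under the refresh `su2MomentumLaw κ`), row 9's
`SU2MultiStepLeapfrogHMC` / `SUNMultiStepLeapfrogHMC` (`su2MomentumLaw`, `measurable_sunLeapfrogProposalN`); nothing is
cited as a fact; no number.

* `one_sub_abs_le_min_one_exp_neg` — `1 − |x| ≤ min(1, e^{−x})`: the Metropolis acceptance probability is at least one
  minus the modulus of the energy error; `su2Momentum_pi_norm_le_sum_norm` — `‖p‖_∞ ≤ Σ_l‖p_l‖`.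
* **`su2LeapfrogProposalN_meanAcceptance_ge`** — for ANY measurable action `S` with `a ↦ S(e_ε(a)·W)` differentiable
  at `0`, a MEASURABLE coordinate gradient `D` with `‖D(W)_l‖ ≤ D_max`, `‖D(W) − D(W')‖ ≤ K‖coeConfig W − coeConfig W'‖`,
  `κ > 0` and the consistent half kick: from EVERY configuration `q`,
  `∫ min(1, e^{−ΔH(q,p)}) d(su2MomentumLaw κ)(p) ≥ 1 − n·K|ε|·(8·|ι|²·3/(2κ) + (8b + 8c₁ + c₂)·|ι|·2/√(πκ) + b(8c₁ + c₂))`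
  — the refresh-averaged acceptance of the exact kernel's proposal is `1 − O(nε²)` once `K, D_max = O(ε)` (as they are
  for the tree's exact forces, `D^ε S̃ = (ε/κ_Φ)Φ`), UNIFORMLY in `q`, hence also in equilibrium; the bound is quadratic
  in the number of links through `E(Σ‖p_l‖)²` (an honest pointwise-law bound, not the `V^{1/4}` law);
* **`su2LeapfrogProposalN_meanAcceptance_ge_integral`** — hence for EVERY probability law `μ` of the configuration
  (initial or invariant) the `μ ⊗ refresh`-averaged acceptance `∫∫ min(1, e^{−ΔH}) ≥` the same bound.

NOT CLAIMED: the equilibrium average as an identity (needs the configuration marginal; the bound is uniform in `q`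
so none is needed); the Gaussian/erfc model of `ΔH`; optimal constants; the instantiation for the two members (their
`D¹S̃` is delivered measurable, bounded, Lipschitz by `SU2WilsonFlowLOExactForceRegular` / `SU2ResidualExactForceRegular`
— compose with `SU2WilsonFlowLOLeapfrogEnergyError` §1); floating point; any number.
-/

noncomputable section

namespace Summit.Ventures.LatticeQCDFlow.Exactness

open Set Function MeasureTheory NormedSpace
open Literature.MathematicalPhysics.QuantumFieldTheory
open scoped Matrix Matrix.Norms.Operator InnerProductSpace ENNReal

set_option backward.isDefEq.respectTransparency false

section MeanAcceptance

variable {ι : Type*} [Fintype ι] [DecidableEq ι]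

/-- `1 − |x| ≤ min(1, e^{−x})`: the Metropolis acceptance probability is at least one minus the energy error. -/
theorem one_sub_abs_le_min_one_exp_neg (x : ℝ) : 1 - |x| ≤ min 1 (Real.exp (-x)) := by
  rcases le_or_gt x 0 with hx | hx
  · rw [min_eq_left ((Real.one_le_exp_iff).2 (by linarith))]
    linarith [abs_nonneg x]
  · rw [abs_of_pos hx]
    refine le_min (by linarith) ?_
    linarith [Real.add_one_le_exp (-x)]

omit [DecidableEq ι] in
/-- The sup norm of the momenta is at most the sum of the link norms. -/
theorem su2Momentum_pi_norm_le_sum_norm (p : ι → EuclideanSpace ℝ (Fin 3)) : ‖p‖ ≤ ∑ l, ‖p l‖ :=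
  (pi_norm_le_iff_of_nonneg (Finset.sum_nonneg fun m _ => norm_nonneg (p m))).2 fun l =>
    Finset.single_le_sum (fun m _ => norm_nonneg (p m)) (Finset.mem_univ l)

/-- **THE MEAN ACCEPTANCE OF THE ENGINE'S `n`-STEP `SU(2)` PROPOSAL IS AT LEAST `1 − O(nε²)`, EXPLICITLY.**  For ANY
measurable action `S` with `a ↦ S(e_ε(a)·W)` differentiable at `0`, a measurable coordinate gradient `D = D^ε S`
with `‖D(W)_l‖ ≤ D_max` and `‖D(W) − D(W')‖ ≤ K‖coeConfig W − coeConfig W'‖`, kinetic coefficient `κ > 0` and the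
consistent half kick `g = −D/(4κ)`: from EVERY configuration `q`, the acceptance probability of the proposal
`Ψ_n = sunLeapfrogProposalN … ε g n` averaged over the momentum refresh `p ∼ su2MomentumLaw κ` satisfies
`∫ min(1, e^{−ΔH(q,p)}) dp ≥ 1 − n·K|ε|·(8·|ι|²·3/(2κ) + (8b + 8c₁ + c₂)·|ι|·2/√(πκ) + b(8c₁ + c₂))` with
`b = (2n+1)D_max/(4κ)`, `c₁ = (2n+1)|ι|D_max/(4κ)`, `c₂ = |ι|D_max/κ` — with `K, D_max = O(ε)` this is
`1 − O(nε²·|ι|²)`, uniformly in `q` (hence also in equilibrium). -/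
theorem su2LeapfrogProposalN_meanAcceptance_ge (S : (ι → Matrix.specialUnitaryGroup (Fin 2) ℂ) → ℝ) (ε κ : ℝ)
    (hκ : 0 < κ) (hS : Measurable S)
    (hd : ∀ W : ι → Matrix.specialUnitaryGroup (Fin 2) ℂ,
      DifferentiableAt ℝ (fun a : ι → EuclideanSpace ℝ (Fin 3) => S (su2ExpDrift ε a * W)) 0)
    {Dmax K : ℝ} (hD0 : 0 ≤ Dmax) (hK0 : 0 ≤ K) (hDm : Measurable (fun (W : ι → Matrix.specialUnitaryGroup (Fin 2) ℂ) (l : ι) => WithLp.toLp 2 (fun i : Fin 3 => fderiv ℝ (fun a : ι → EuclideanSpace ℝ (Fin 3) => S (su2ExpDrift ε a * W)) 0 (Pi.single l (EuclideanSpace.single i (1 : ℝ))))))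
    (hDb : ∀ (W : ι → Matrix.specialUnitaryGroup (Fin 2) ℂ) (l : ι), ‖(fun (W : ι → Matrix.specialUnitaryGroup (Fin 2) ℂ) (l : ι) => WithLp.toLp 2 (fun i : Fin 3 => fderiv ℝ (fun a : ι → EuclideanSpace ℝ (Fin 3) => S (su2ExpDrift ε a * W)) 0 (Pi.single l (EuclideanSpace.single i (1 : ℝ))))) W l‖ ≤ Dmax)
    (hDK : ∀ W W' : ι → Matrix.specialUnitaryGroup (Fin 2) ℂ, ‖(fun (W : ι → Matrix.specialUnitaryGroup (Fin 2) ℂ) (l : ι) => WithLp.toLp 2 (fun i : Fin 3 => fderiv ℝ (fun a : ι → EuclideanSpace ℝ (Fin 3) => S (su2ExpDrift ε a * W)) 0 (Pi.single l (EuclideanSpace.single i (1 : ℝ))))) W - (fun (W : ι → Matrix.specialUnitaryGroup (Fin 2) ℂ) (l : ι) => WithLp.toLp 2 (fun i : Fin 3 => fderiv ℝ (fun a : ι → EuclideanSpace ℝ (Fin 3) => S (su2ExpDrift ε a * W)) 0 (Pi.single l (EuclideanSpace.single i (1 : ℝ))))) W'‖ ≤ K * ‖coeConfig W - coeConfig 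W'‖)
    (q : ι → Matrix.specialUnitaryGroup (Fin 2) ℂ) (n : ℕ) :
    1 - n * (K * |ε|) *
        (8 * ((Fintype.card ι : ℝ) ^ 2 * (3 / (2 * κ))) +
          (8 * ((2 * n + 1) * (Dmax / (4 * κ))) + 8 * ((2 * n + 1) * (Fintype.card ι * (Dmax / (4 * κ)))) +
              Fintype.card ι * Dmax / κ) * (Fintype.card ι * (2 / Real.sqrt (Real.pi * κ))) +
          (2 * n + 1) * (Dmax / (4 * κ)) * (8 * ((2 * n + 1) * (Fintype.card ι * (Dmax / (4 * κ)))) + Fintype.card ι * Dmax / κ)) ≤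
      ∫ p, min 1 (Real.exp (-((S (sunLeapfrogProposalN pauliCoordι pauliCoordι_skew ε (fun (W : ι → Matrix.specialUnitaryGroup (Fin 2) ℂ) (l : ι) => -(1 / (4 * κ)) • (fun (W : ι → Matrix.specialUnitaryGroup (Fin 2) ℂ) (l : ι) => WithLp.toLp 2 (fun i : Fin 3 => fderiv ℝ (fun a : ι → EuclideanSpace ℝ (Fin 3) => S (su2ExpDrift ε a * W)) 0 (Pi.single l (EuclideanSpace.single i (1 : ℝ))))) W l) n (q, p)).1 +
          su2Kinetic κ (sunLeapfrogProposalN pauliCoordι pauliCoordι_skew ε (fun (W : ι → Matrix.specialUnitaryGroup (Fin 2) ℂ) (l : ι) => -(1 / (4 * κ)) • (fun (W : ι → Matrix.specialUnitaryGroup (Fin 2) ℂ) (l : ι) => WithLp.toLp 2 (fun i : Fin 3 => fderiv ℝ (fun a : ι → EuclideanSpace ℝ (Fin 3) => S (su2ExpDrift ε a * W)) 0 (Pi.single l (EuclideanSpace.single i (1 : ℝ))))) W l) n (q, p)).2) - (S q + su2Kinetic κ p))))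
        ∂(su2MomentumLaw (ι := ι) κ) := by
  haveI : Fact (0 < κ) := ⟨hκ⟩
  -- abbreviations
  set b : ℝ := (2 * n + 1) * (Dmax / (4 * κ)) with hb
  set c₁ : ℝ := (2 * n + 1) * (Fintype.card ι * (Dmax / (4 * κ))) with hc₁
  set c₂ : ℝ := Fintype.card ι * Dmax / κ with hc₂
  set α : ℝ := 8 * b + 8 * c₁ + c₂ with hα
  have hb0 : 0 ≤ b := by rw [hb]; positivity
  have hc₁0 : 0 ≤ c₁ := by rw [hc₁]; positivity
  have hc₂0 : 0 ≤ c₂ := by rw [hc₂]; positivity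
  have hα0 : 0 ≤ α := by rw [hα]; positivity
  set ΔH : (ι → EuclideanSpace ℝ (Fin 3)) → ℝ := fun p =>
    (S (sunLeapfrogProposalN pauliCoordι pauliCoordι_skew ε (fun (W : ι → Matrix.specialUnitaryGroup (Fin 2) ℂ) (l : ι) => -(1 / (4 * κ)) • (fun (W : ι → Matrix.specialUnitaryGroup (Fin 2) ℂ) (l : ι) => WithLp.toLp 2 (fun i : Fin 3 => fderiv ℝ (fun a : ι → EuclideanSpace ℝ (Fin 3) => S (su2ExpDrift ε a * W)) 0 (Pi.single l (EuclideanSpace.single i (1 : ℝ))))) W l) n (q, p)).1 +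
      su2Kinetic κ (sunLeapfrogProposalN pauliCoordι pauliCoordι_skew ε (fun (W : ι → Matrix.specialUnitaryGroup (Fin 2) ℂ) (l : ι) => -(1 / (4 * κ)) • (fun (W : ι → Matrix.specialUnitaryGroup (Fin 2) ℂ) (l : ι) => WithLp.toLp 2 (fun i : Fin 3 => fderiv ℝ (fun a : ι → EuclideanSpace ℝ (Fin 3) => S (su2ExpDrift ε a * W)) 0 (Pi.single l (EuclideanSpace.single i (1 : ℝ))))) W l) n (q, p)).2) - (S q + su2Kinetic κ p) with hΔH
  -- the pointwise energy-error law, as a polynomial in Σ_l ‖p_l‖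
  have hpt : ∀ p : ι → EuclideanSpace ℝ (Fin 3),
      |ΔH p| ≤ n * (K * |ε|) * (8 * (∑ l, ‖p l‖) ^ 2 + α * ∑ l, ‖p l‖ + b * (8 * c₁ + c₂)) := by
    intro p
    have h := abs_su2LeapfrogProposalN_energy_error_le S ε κ hκ hd hD0 hK0 hDb hDK q p n
    have hs := su2Momentum_pi_norm_le_sum_norm p
    have hs0 : 0 ≤ ∑ l, ‖p l‖ := Finset.sum_nonneg fun l _ => norm_nonneg _
    refine h.trans ?_
    rw [hα]
    have h1 : K * (‖p‖ + (2 * n + 1) * (Dmax / (4 * κ))) ≤ K * (∑ l, ‖p l‖ + b) := by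
      rw [hb]; exact mul_le_mul_of_nonneg_left (by linarith) hK0
    have h2 : (0 : ℝ) ≤ 8 * (∑ l, ‖p l‖ + (2 * n + 1) * (Fintype.card ι * (Dmax / (4 * κ)))) + Fintype.card ι * Dmax / κ := by
      positivity
    calc (n : ℝ) * (K * (‖p‖ + (2 * n + 1) * (Dmax / (4 * κ))) * |ε| *
          (8 * (∑ l, ‖p l‖ + (2 * n + 1) * (Fintype.card ι * (Dmax / (4 * κ)))) + Fintype.card ι * Dmax / κ))
        ≤ n * (K * (∑ l, ‖p l‖ + b) * |ε| *
          (8 * (∑ l, ‖p l‖ + (2 * n + 1) * (Fintype.card ι * (Dmax / (4 * κ)))) + Fintype.card ι * Dmax / κ)) := by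
          gcongr
      _ = n * (K * |ε|) * (8 * (∑ l, ‖p l‖) ^ 2 + (8 * b + 8 * c₁ + c₂) * ∑ l, ‖p l‖ + b * (8 * c₁ + c₂)) := by
          rw [hc₁, hc₂]; ring
  -- measurability of ΔH and integrability of both sides
  have hg : Measurable (fun (W : ι → Matrix.specialUnitaryGroup (Fin 2) ℂ) (l : ι) => -(1 / (4 * κ)) • (fun (W : ι → Matrix.specialUnitaryGroup (Fin 2) ℂ) (l : ι) => WithLp.toLp 2 (fun i : Fin 3 => fderiv ℝ (fun a : ι → EuclideanSpace ℝ (Fin 3) => S (su2ExpDrift ε a * W)) 0 (Pi.single l (EuclideanSpace.single i (1 : ℝ))))) W l) := hDm.const_smul (-(1 / (4 * κ)))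
  have hΨ : Measurable (⇑(sunLeapfrogProposalN pauliCoordι pauliCoordι_skew ε (fun (W : ι → Matrix.specialUnitaryGroup (Fin 2) ℂ) (l : ι) => -(1 / (4 * κ)) • (fun (W : ι → Matrix.specialUnitaryGroup (Fin 2) ℂ) (l : ι) => WithLp.toLp 2 (fun i : Fin 3 => fderiv ℝ (fun a : ι → EuclideanSpace ℝ (Fin 3) => S (su2ExpDrift ε a * W)) 0 (Pi.single l (EuclideanSpace.single i (1 : ℝ))))) W l) n)) :=
    measurable_sunLeapfrogProposalN pauliCoordι pauliCoordι_skew ε n hg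
  have hΔm : Measurable ΔH := by
    rw [hΔH]
    have hq : Measurable fun p : ι → EuclideanSpace ℝ (Fin 3) =>
        sunLeapfrogProposalN pauliCoordι pauliCoordι_skew ε (fun (W : ι → Matrix.specialUnitaryGroup (Fin 2) ℂ) (l : ι) => -(1 / (4 * κ)) • (fun (W : ι → Matrix.specialUnitaryGroup (Fin 2) ℂ) (l : ι) => WithLp.toLp 2 (fun i : Fin 3 => fderiv ℝ (fun a : ι → EuclideanSpace ℝ (Fin 3) => S (su2ExpDrift ε a * W)) 0 (Pi.single l (EuclideanSpace.single i (1 : ℝ))))) W l) n (q, p) := hΨ.comp measurable_prodMk_left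
    exact ((hS.comp (measurable_fst.comp hq)).add ((measurable_su2Kinetic κ).comp (measurable_snd.comp hq))).sub
      (measurable_const.add (measurable_su2Kinetic κ))
  have hacc_int : Integrable (fun p => min 1 (Real.exp (-ΔH p))) (su2MomentumLaw (ι := ι) κ) := by
    refine (integrable_const (1 : ℝ)).mono' (measurable_const.min (hΔm.neg.exp)).aestronglyMeasurable
      (Filter.Eventually.of_forall fun p => ?_)
    rw [Real.norm_eq_abs, abs_of_nonneg (le_min zero_le_one (Real.exp_pos _).le)]
    exact min_le_left _ _
  have hint1 : Integrable (fun p : ι → EuclideanSpace ℝ (Fin 3) => ∑ l, ‖p l‖) (su2MomentumLaw (ι := ι) κ) :=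
    integrable_finsetSum _ fun l _ => by simpa only [pow_one] using integrable_norm_apply_pow_su2MomentumLaw (ι := ι) hκ 1 l
  have hint2 : Integrable (fun p : ι → EuclideanSpace ℝ (Fin 3) => (∑ l, ‖p l‖) ^ 2) (su2MomentumLaw (ι := ι) κ) := by
    have hint2' : Integrable (fun p : ι → EuclideanSpace ℝ (Fin 3) => (Fintype.card ι : ℝ) * ∑ l, ‖p l‖ ^ 2) (su2MomentumLaw (ι := ι) κ) :=
      (integrable_finsetSum _ fun l _ => integrable_norm_apply_pow_su2MomentumLaw (ι := ι) hκ 2 l).const_mul _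
    refine hint2'.mono' ((Finset.measurable_sum _ fun l _ => (measurable_pi_apply l).norm).pow_const 2).aestronglyMeasurable
      (Filter.Eventually.of_forall fun p => ?_)
    rw [Real.norm_eq_abs, abs_of_nonneg (sq_nonneg _)]
    have h := sq_sum_le_card_mul_sum_sq (s := Finset.univ) (f := fun l => ‖p l‖)
    simpa only [Finset.card_univ] using h
  have h8 : Integrable (fun p : ι → EuclideanSpace ℝ (Fin 3) => 8 * (∑ l, ‖p l‖) ^ 2) (su2MomentumLaw (ι := ι) κ) :=
    hint2.const_mul 8
  have hαs : Integrable (fun p : ι → EuclideanSpace ℝ (Fin 3) => α * ∑ l, ‖p l‖) (su2MomentumLaw (ι := ι) κ) :=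
    hint1.const_mul α
  have h8α : Integrable (fun p : ι → EuclideanSpace ℝ (Fin 3) => 8 * (∑ l, ‖p l‖) ^ 2 + α * ∑ l, ‖p l‖) (su2MomentumLaw (ι := ι) κ) :=
    h8.add hαs
  have hq3 : Integrable (fun p : ι → EuclideanSpace ℝ (Fin 3) => 8 * (∑ l, ‖p l‖) ^ 2 + α * ∑ l, ‖p l‖ + b * (8 * c₁ + c₂))
      (su2MomentumLaw (ι := ι) κ) := h8α.add (integrable_const _)
  have hCq : Integrable (fun p : ι → EuclideanSpace ℝ (Fin 3) =>
      n * (K * |ε|) * (8 * (∑ l, ‖p l‖) ^ 2 + α * ∑ l, ‖p l‖ + b * (8 * c₁ + c₂))) (su2MomentumLaw (ι := ι) κ) :=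
    hq3.const_mul _
  have hpoly_int : Integrable (fun p : ι → EuclideanSpace ℝ (Fin 3) =>
      1 - n * (K * |ε|) * (8 * (∑ l, ‖p l‖) ^ 2 + α * ∑ l, ‖p l‖ + b * (8 * c₁ + c₂))) (su2MomentumLaw (ι := ι) κ) :=
    (integrable_const _).sub hCq
  -- integrate the pointwise bound
  have hmono : ∫ p, (1 - n * (K * |ε|) * (8 * (∑ l, ‖p l‖) ^ 2 + α * ∑ l, ‖p l‖ + b * (8 * c₁ + c₂))) ∂(su2MomentumLaw (ι := ι) κ) ≤
      ∫ p, min 1 (Real.exp (-ΔH p)) ∂(su2MomentumLaw (ι := ι) κ) :=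
    integral_mono hpoly_int hacc_int fun p =>
      ((sub_le_sub_left (hpt p) 1).trans (one_sub_abs_le_min_one_exp_neg (ΔH p)))
  -- evaluate the left-hand side with the moments of the refresh law
  have hlhs : ∫ p, (1 - n * (K * |ε|) * (8 * (∑ l, ‖p l‖) ^ 2 + α * ∑ l, ‖p l‖ + b * (8 * c₁ + c₂))) ∂(su2MomentumLaw (ι := ι) κ) =
      1 - n * (K * |ε|) * (8 * ∫ p, (∑ l, ‖p l‖) ^ 2 ∂(su2MomentumLaw (ι := ι) κ) +
        α * ∫ p, ∑ l, ‖p l‖ ∂(su2MomentumLaw (ι := ι) κ) + b * (8 * c₁ + c₂)) := by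
    rw [integral_sub (integrable_const _) hCq, integral_const, integral_const_mul, integral_add h8α (integrable_const _),
      integral_add h8 hαs, integral_const_mul, integral_const_mul, integral_const]
    simp only [probReal_univ, smul_eq_mul, one_mul]
  have hE2 := integral_sq_sum_norm_su2MomentumLaw_le (ι := ι) hκ
  have hE1 := integral_sum_norm_su2MomentumLaw (ι := ι) hκ
  have hfin : 1 - n * (K * |ε|) * (8 * ((Fintype.card ι : ℝ) ^ 2 * (3 / (2 * κ))) + α * (Fintype.card ι * (2 / Real.sqrt (Real.pi * κ))) +
      b * (8 * c₁ + c₂)) ≤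
      1 - n * (K * |ε|) * (8 * ∫ p, (∑ l, ‖p l‖) ^ 2 ∂(su2MomentumLaw (ι := ι) κ) +
        α * ∫ p, ∑ l, ‖p l‖ ∂(su2MomentumLaw (ι := ι) κ) + b * (8 * c₁ + c₂)) := by
    rw [hE1]
    have hcoef : 0 ≤ (n : ℝ) * (K * |ε|) := by positivity
    nlinarith [hE2, hcoef]
  have hgoal := (hfin.trans (hlhs.symm.le)).trans hmono
  rw [hα, hb, hc₁, hc₂] at hgoal
  simpa only [hΔH] using hgoal

/-- **… and therefore in ANY law of the configuration** (an initial law, or the invariant law in equilibrium):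
for every probability measure `μ` on the configurations the `μ ⊗ refresh`-averaged acceptance probability of the
engine's `n`-step proposal obeys the same bound,
`∫∫ min(1, e^{−ΔH(q,p)}) d(su2MomentumLaw κ)(p) dμ(q) ≥ 1 − n·K|ε|·(8·|ι|²·3/(2κ) + (8b + 8c₁ + c₂)·|ι|·2/√(πκ) + b(8c₁ + c₂))`. -/
theorem su2LeapfrogProposalN_meanAcceptance_ge_integral (S : (ι → Matrix.specialUnitaryGroup (Fin 2) ℂ) → ℝ) (ε κ : ℝ)
    (hκ : 0 < κ) (hS : Measurable S)
    (hd : ∀ W : ι → Matrix.specialUnitaryGroup (Fin 2) ℂ,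
      DifferentiableAt ℝ (fun a : ι → EuclideanSpace ℝ (Fin 3) => S (su2ExpDrift ε a * W)) 0)
    {Dmax K : ℝ} (hD0 : 0 ≤ Dmax) (hK0 : 0 ≤ K) (hDm : Measurable (fun (W : ι → Matrix.specialUnitaryGroup (Fin 2) ℂ) (l : ι) => WithLp.toLp 2 (fun i : Fin 3 => fderiv ℝ (fun a : ι → EuclideanSpace ℝ (Fin 3) => S (su2ExpDrift ε a * W)) 0 (Pi.single l (EuclideanSpace.single i (1 : ℝ))))))
    (hDb : ∀ (W : ι → Matrix.specialUnitaryGroup (Fin 2) ℂ) (l : ι), ‖(fun (W : ι → Matrix.specialUnitaryGroup (Fin 2) ℂ) (l : ι) => WithLp.toLp 2 (fun i : Fin 3 => fderiv ℝ (fun a : ι → EuclideanSpace ℝ (Fin 3) => S (su2ExpDrift ε a * W)) 0 (Pi.single l (EuclideanSpace.single i (1 : ℝ))))) W l‖ ≤ Dmax)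
    (hDK : ∀ W W' : ι → Matrix.specialUnitaryGroup (Fin 2) ℂ, ‖(fun (W : ι → Matrix.specialUnitaryGroup (Fin 2) ℂ) (l : ι) => WithLp.toLp 2 (fun i : Fin 3 => fderiv ℝ (fun a : ι → EuclideanSpace ℝ (Fin 3) => S (su2ExpDrift ε a * W)) 0 (Pi.single l (EuclideanSpace.single i (1 : ℝ))))) W - (fun (W : ι → Matrix.specialUnitaryGroup (Fin 2) ℂ) (l : ι) => WithLp.toLp 2 (fun i : Fin 3 => fderiv ℝ (fun a : ι → EuclideanSpace ℝ (Fin 3) => S (su2ExpDrift ε a * W)) 0 (Pi.single l (EuclideanSpace.single i (1 : ℝ))))) W'‖ ≤ K * ‖coeConfig W - coeConfig W'‖)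
    (μ : Measure (ι → Matrix.specialUnitaryGroup (Fin 2) ℂ)) [IsProbabilityMeasure μ] (n : ℕ) :
    1 - n * (K * |ε|) *
        (8 * ((Fintype.card ι : ℝ) ^ 2 * (3 / (2 * κ))) +
          (8 * ((2 * n + 1) * (Dmax / (4 * κ))) + 8 * ((2 * n + 1) * (Fintype.card ι * (Dmax / (4 * κ)))) +
              Fintype.card ι * Dmax / κ) * (Fintype.card ι * (2 / Real.sqrt (Real.pi * κ))) +
          (2 * n + 1) * (Dmax / (4 * κ)) * (8 * ((2 * n + 1) * (Fintype.card ι * (Dmax / (4 * κ)))) + Fintype.card ι * Dmax / κ)) ≤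
      ∫ q, ∫ p, min 1 (Real.exp (-((S (sunLeapfrogProposalN pauliCoordι pauliCoordι_skew ε (fun (W : ι → Matrix.specialUnitaryGroup (Fin 2) ℂ) (l : ι) => -(1 / (4 * κ)) • (fun (W : ι → Matrix.specialUnitaryGroup (Fin 2) ℂ) (l : ι) => WithLp.toLp 2 (fun i : Fin 3 => fderiv ℝ (fun a : ι → EuclideanSpace ℝ (Fin 3) => S (su2ExpDrift ε a * W)) 0 (Pi.single l (EuclideanSpace.single i (1 : ℝ))))) W l) n (q, p)).1 +
          su2Kinetic κ (sunLeapfrogProposalN pauliCoordι pauliCoordι_skew ε (fun (W : ι → Matrix.specialUnitaryGroup (Fin 2) ℂ) (l : ι) => -(1 / (4 * κ)) • (fun (W : ι → Matrix.specialUnitaryGroup (Fin 2) ℂ) (l : ι) => WithLp.toLp 2 (fun i : Fin 3 => fderiv ℝ (fun a : ι → EuclideanSpace ℝ (Fin 3) => S (su2ExpDrift ε a * W)) 0 (Pi.single l (EuclideanSpace.single i (1 : ℝ))))) W l) n (q, p)).2) - (S q + su2Kinetic κ p))))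
        ∂(su2MomentumLaw (ι := ι) κ) ∂μ := by
  haveI : Fact (0 < κ) := ⟨hκ⟩
  have hpt := fun q => su2LeapfrogProposalN_meanAcceptance_ge S ε κ hκ hS hd hD0 hK0 hDm hDb hDK q n
  -- joint measurability of the acceptance probability
  have hg : Measurable (fun (W : ι → Matrix.specialUnitaryGroup (Fin 2) ℂ) (l : ι) => -(1 / (4 * κ)) • (fun (W : ι → Matrix.specialUnitaryGroup (Fin 2) ℂ) (l : ι) => WithLp.toLp 2 (fun i : Fin 3 => fderiv ℝ (fun a : ι → EuclideanSpace ℝ (Fin 3) => S (su2ExpDrift ε a * W)) 0 (Pi.single l (EuclideanSpace.single i (1 : ℝ))))) W l) := hDm.const_smul (-(1 / (4 * κ)))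
  have hΨ : Measurable (⇑(sunLeapfrogProposalN pauliCoordι pauliCoordι_skew ε (fun (W : ι → Matrix.specialUnitaryGroup (Fin 2) ℂ) (l : ι) => -(1 / (4 * κ)) • (fun (W : ι → Matrix.specialUnitaryGroup (Fin 2) ℂ) (l : ι) => WithLp.toLp 2 (fun i : Fin 3 => fderiv ℝ (fun a : ι → EuclideanSpace ℝ (Fin 3) => S (su2ExpDrift ε a * W)) 0 (Pi.single l (EuclideanSpace.single i (1 : ℝ))))) W l) n)) :=
    measurable_sunLeapfrogProposalN pauliCoordι pauliCoordι_skew ε n hg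
  have hjoint : Measurable fun z : (ι → Matrix.specialUnitaryGroup (Fin 2) ℂ) × (ι → EuclideanSpace ℝ (Fin 3)) =>
      min 1 (Real.exp (-((S (sunLeapfrogProposalN pauliCoordι pauliCoordι_skew ε (fun (W : ι → Matrix.specialUnitaryGroup (Fin 2) ℂ) (l : ι) => -(1 / (4 * κ)) • (fun (W : ι → Matrix.specialUnitaryGroup (Fin 2) ℂ) (l : ι) => WithLp.toLp 2 (fun i : Fin 3 => fderiv ℝ (fun a : ι → EuclideanSpace ℝ (Fin 3) => S (su2ExpDrift ε a * W)) 0 (Pi.single l (EuclideanSpace.single i (1 : ℝ))))) W l) n z).1 +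
          su2Kinetic κ (sunLeapfrogProposalN pauliCoordι pauliCoordι_skew ε (fun (W : ι → Matrix.specialUnitaryGroup (Fin 2) ℂ) (l : ι) => -(1 / (4 * κ)) • (fun (W : ι → Matrix.specialUnitaryGroup (Fin 2) ℂ) (l : ι) => WithLp.toLp 2 (fun i : Fin 3 => fderiv ℝ (fun a : ι → EuclideanSpace ℝ (Fin 3) => S (su2ExpDrift ε a * W)) 0 (Pi.single l (EuclideanSpace.single i (1 : ℝ))))) W l) n z).2) - (S z.1 + su2Kinetic κ z.2)))) :=
    measurable_const.min ((((hS.comp (measurable_fst.comp hΨ)).add ((measurable_su2Kinetic κ).comp (measurable_snd.comp hΨ))).sub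
      ((hS.comp measurable_fst).add ((measurable_su2Kinetic κ).comp measurable_snd))).neg.exp)
  have hF : Integrable (fun q : ι → Matrix.specialUnitaryGroup (Fin 2) ℂ => ∫ p, min 1 (Real.exp (-((S (sunLeapfrogProposalN pauliCoordι pauliCoordι_skew ε (fun (W : ι → Matrix.specialUnitaryGroup (Fin 2) ℂ) (l : ι) => -(1 / (4 * κ)) • (fun (W : ι → Matrix.specialUnitaryGroup (Fin 2) ℂ) (l : ι) => WithLp.toLp 2 (fun i : Fin 3 => fderiv ℝ (fun a : ι → EuclideanSpace ℝ (Fin 3) => S (su2ExpDrift ε a * W)) 0 (Pi.single l (EuclideanSpace.single i (1 : ℝ))))) W l) n (q, p)).1 +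
          su2Kinetic κ (sunLeapfrogProposalN pauliCoordι pauliCoordι_skew ε (fun (W : ι → Matrix.specialUnitaryGroup (Fin 2) ℂ) (l : ι) => -(1 / (4 * κ)) • (fun (W : ι → Matrix.specialUnitaryGroup (Fin 2) ℂ) (l : ι) => WithLp.toLp 2 (fun i : Fin 3 => fderiv ℝ (fun a : ι → EuclideanSpace ℝ (Fin 3) => S (su2ExpDrift ε a * W)) 0 (Pi.single l (EuclideanSpace.single i (1 : ℝ))))) W l) n (q, p)).2) - (S q + su2Kinetic κ p))))
        ∂(su2MomentumLaw (ι := ι) κ)) μ := by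
    refine (integrable_const (1 : ℝ)).mono' (hjoint.stronglyMeasurable.integral_prod_right'
      (ν := su2MomentumLaw (ι := ι) κ)).aestronglyMeasurable (Filter.Eventually.of_forall fun q => ?_)
    refine (norm_integral_le_of_norm_le_const (C := 1) (Filter.Eventually.of_forall fun p => ?_)).trans ?_
    · rw [Real.norm_eq_abs, abs_of_nonneg (le_min zero_le_one (Real.exp_pos _).le)]
      exact min_le_left _ _
    · rw [probReal_univ, mul_one]
  calc _ = ∫ _q : ι → Matrix.specialUnitaryGroup (Fin 2) ℂ, (1 - n * (K * |ε|) *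
        (8 * ((Fintype.card ι : ℝ) ^ 2 * (3 / (2 * κ))) +
          (8 * ((2 * n + 1) * (Dmax / (4 * κ))) + 8 * ((2 * n + 1) * (Fintype.card ι * (Dmax / (4 * κ)))) +
              Fintype.card ι * Dmax / κ) * (Fintype.card ι * (2 / Real.sqrt (Real.pi * κ))) +
          (2 * n + 1) * (Dmax / (4 * κ)) * (8 * ((2 * n + 1) * (Fintype.card ι * (Dmax / (4 * κ)))) + Fintype.card ι * Dmax / κ))) ∂μ := by
          rw [integral_const, probReal_univ, one_smul]
    _ ≤ _ := integral_mono (integrable_const _) hF hpt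

end MeanAcceptance

end Summit.Ventures.LatticeQCDFlow.Exactness
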